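import Literature.NumberTheory.QuadraticFields.ThreeTorsion
import Literature.NumberTheory.QuadraticFields.RealQuadraticRegulator
import Literature.NumberTheory.QuadraticFields.ReducedQuadraticIrrationals
import Literature.NumberTheory.QuadraticFields.ReducedIdealsPerClass
import Literature.NumberTheory.QuadraticFields.ScholzMirrorTorsionWitnessTools
import Mathlib.NumberTheory.NumberField.Units.Regulator
import Mathlib.NumberTheory.NumberField.ClassNumber
import HarnessLib

/-!
# Crux `ArithStatLadder.IqThreeMemBQP` (stmt-QuantumAdvantage-2424), line `scholz-mirror-siegel` — stub `stub_redIdealsPerClass` (S6a)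

Registered stub of the line skeleton `Cruxes/IqThreeMemBQP/Lines/scholz_mirror_siegel.lean` (reshape r5:
the signature below is stated over tree constants only and must stay BYTE-IDENTICAL to the registered
one — edit only the proof and add helper lemmas above it; adjust the imports freely).

Proof summary. The number theory is the tree's cycle of reduced ideals of an ideal class
(`Literature/NumberTheory/QuadraticFields/ReducedIdealCycleOfClass.lean`, `ReducedIdealsPerClass.lean`,
landed for this stub): for a `ℤ`-basis `(1, ω)` of `𝓞 F` with `ω² = n + tω`, `D = t² + 4n`, and a real
embedding `σ` with `2σ(ω) − t = √D`, `Quadratic.exists_reduced_pairs_of_class` lists, for every class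
`C`, `ℓ` distinct reduced pairs `(a, b)` (the integer inequalities of the statement) whose ideals
`(a, ω − (t − b)/2) = [a, (b + √D)/2]` lie in `C`, with `log ε_D ≤ ℓ · log(2√D)` (Minkowski + Hermite
form for a reduced representative, the baby step `(A)𝔞' = (η')𝔞` for class invariance and injectivity,
and the unit `∏ψ_k ≥ ε_D` of a period, `ψ_k < 2√D`). Here: `R_F = log ε_D`
(`Quadratic.regulator_eq_log_fundUnit'`), `D = fundDiscr m` (`Quadratic.discr_eq_fundDiscr`, so
`4 ∣ D ↔ m ≢ 1 (4)`), the basis is flipped if necessary so that `2ω − t = β` with `β = 2α` (`4 ∣ D`)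
resp. `β = α` (`exists_basis_two_mul_sub_eq`), `σ` is chosen with `σ(α) > 0`
(`exists_ringHom_apply_pos`, via the automorphism `α ↦ −α`), and the S5 format is bridged by the
parity computations `b/2 + α = ω − (t − b)/2` (`4 ∣ D`: `t, b` even) and
`b + α = 2(ω − (t − b)/2)` (`D ≡ 1 (4)`: `t, b` odd), i.e. the format ideal is `[a, (b+√D)/2]` resp.
twice it (same class); finally `Fin ℓ` injects into the (finite) subtype.
-/

noncomputable section

namespace Summit.QuantumAdvantage.QuantumAdvantage.Theorems.ArithStatLadder.IqThreeMemBQP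

open scoped NumberField nonZeroDivisors
open Literature.NumberTheory.QuadraticFields
open Module NumberField

/-! ## Helper lemmas -/

/-! ### (a) A real embedding with `σ(α) > 0` -/

/-- **A real embedding making a given square root positive**: a real quadratic field containing `α`,
`α² = m ≥ 2` squarefree, has a real embedding `σ` with `σ(α) > 0` (compose any real embedding with
the automorphism `α ↦ −α` of `ScholzMirrorTorsionWitnessTools.lean` if necessary). [folklore] -/
theorem exists_ringHom_apply_pos {F : Type*} [Field F] [NumberField F] (h2 : finrank ℚ F = 2)
    (hd : 0 < NumberField.discr F) {m : ℕ} (hsf : Squarefree m) (hm : 2 ≤ m) {α : F}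
    (hα : α ^ 2 = (m : F)) : ∃ σ : F →+* ℝ, 0 < σ α := by
  obtain ⟨τ⟩ := Quadratic.exists_ringHom_real h2 hd
  have hne : τ α ≠ 0 := by
    intro h0
    have h1 : (τ α) ^ 2 = m := by rw [← map_pow, hα, map_natCast]
    rw [h0] at h1
    have : (m : ℝ) = 0 := by rw [← h1]; ring
    have : m = 0 := by exact_mod_cast this
    omega
  rcases lt_or_gt_of_ne hne with hneg | hpos
  · obtain ⟨e, he⟩ := exists_algEquiv_apply_eq_of_sq_eq h2 h2 hsf hm hα (α' := -α) (by rw [neg_sq, hα])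
    refine ⟨τ.comp (e : F →+* F), ?_⟩
    show 0 < τ (e α)
    rw [he, map_neg]
    linarith
  · exact ⟨τ, hpos⟩

/-! ### (b) Adjusting the integral basis: `2ω − t = β` for a prescribed square root `β` of `d_K` -/

/-- Flipping an integral basis: `(1, ω) ↦ (1, t − ω)` is again a `ℤ`-basis of `𝓞 K`. [folklore] -/
theorem exists_basis_one_eq_sub {K : Type*} [Field K] (b : Basis (Fin 2) ℤ (𝓞 K)) (hb : b 0 = 1)
    (t : ℤ) : ∃ b' : Basis (Fin 2) ℤ (𝓞 K), b' 0 = 1 ∧ b' 1 = (t : 𝓞 K) - b 1 := by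
  set w : Fin 2 → 𝓞 K := ![1, (t : 𝓞 K) - b 1] with hw
  have h0 : w 0 = ((1 : ℤ) : 𝓞 K) + ((0 : ℤ) : 𝓞 K) * b 1 := by simp [hw]
  have h1 : w 1 = ((t : ℤ) : 𝓞 K) + ((-1 : ℤ) : 𝓞 K) * b 1 := by simp [hw]; ring
  have hdet : b.det w = -1 := by
    rw [b.det_apply, Matrix.det_fin_two]
    simp only [b.toMatrix_apply]
    rw [h0, h1, Quadratic.repr_intCast_add_intCast_mul_zero b hb,
      Quadratic.repr_intCast_add_intCast_mul_one b hb, Quadratic.repr_intCast_add_intCast_mul_zero b hb,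
      Quadratic.repr_intCast_add_intCast_mul_one b hb]
    ring
  obtain ⟨hli, hsp⟩ := (Module.Basis.is_basis_iff_det b).mpr (by rw [hdet]; exact isUnit_one.neg)
  refine ⟨Basis.mk hli hsp.ge, ?_, ?_⟩
  · rw [Basis.mk_apply]; simp [hw]
  · rw [Basis.mk_apply]; simp [hw]

/-- **Choosing the integral basis by the sign of `√d_K`**: if `(1, ω₀)` is a `ℤ`-basis with
`ω₀² = n + tω₀` and `β ∈ 𝓞 K` satisfies `β² = t² + 4n`, then `β = ±(2ω₀ − t)`, and after possibly
flipping the basis there is a basis `(1, ω)` with the same `(n, t)` and `2ω − t = β`. [folklore] -/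
theorem exists_basis_two_mul_sub_eq {K : Type*} [Field K] (b₀ : Basis (Fin 2) ℤ (𝓞 K)) (hb₀ : b₀ 0 = 1)
    {t n : ℤ} (hω₀ : b₀ 1 * b₀ 1 = (n : 𝓞 K) + (t : 𝓞 K) * b₀ 1) {β : 𝓞 K}
    (hβ : β ^ 2 = ((t ^ 2 + 4 * n : ℤ) : 𝓞 K)) :
    ∃ b : Basis (Fin 2) ℤ (𝓞 K), b 0 = 1 ∧ b 1 * b 1 = (n : 𝓞 K) + (t : 𝓞 K) * b 1 ∧
      2 * b 1 - (t : 𝓞 K) = β := by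
  have hδ : (2 * b₀ 1 - (t : 𝓞 K)) ^ 2 = ((t ^ 2 + 4 * n : ℤ) : 𝓞 K) := by
    push_cast; linear_combination 4 * hω₀
  rw [← hδ] at hβ
  rcases sq_eq_sq_iff_eq_or_eq_neg.mp hβ with h | h
  · exact ⟨b₀, hb₀, hω₀, h.symm⟩
  · obtain ⟨b, hb, hb1⟩ := exists_basis_one_eq_sub b₀ hb₀ t
    refine ⟨b, hb, ?_, ?_⟩
    · rw [hb1]; linear_combination hω₀
    · rw [hb1, h]; ring

/-! ### (c) Small generic facts -/

/-- Scaling an ideal by a non-zero principal ideal does not change its class. [folklore] -/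
theorem mk0_span_singleton_mul_eq {R : Type*} [CommRing R] [IsDedekindDomain R] {I : Ideal R}
    (hI : I ∈ (Ideal R)⁰) {u : R} (hu : u ≠ 0) (h : Ideal.span {u} * I ∈ (Ideal R)⁰) :
    ClassGroup.mk0 ⟨Ideal.span {u} * I, h⟩ = ClassGroup.mk0 ⟨I, hI⟩ := by
  rw [ClassGroup.mk0_eq_mk0_iff]
  exact ⟨1, u, one_ne_zero, hu, by rw [Ideal.span_singleton_one, Ideal.top_mul]⟩

/-- The pairs `(a, b)` with `a, b ≥ 1`, `b² < D`, `4a ∣ D − b²` form a finite set (`a, b ≤ D`). [folklore] -/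
theorem finite_setOf_pairs (D : ℕ) (P : ℕ × ℕ → Prop) :
    Set.Finite {ab : ℕ × ℕ | (0 < ab.1 ∧ 0 < ab.2 ∧ ab.2 ^ 2 < D ∧ 4 * ab.1 ∣ D - ab.2 ^ 2 ∧ P ab)} := by
  refine (Finset.finite_toSet (Finset.range (D + 1) ×ˢ Finset.range (D + 1))).subset ?_
  rintro ⟨a, b⟩ ⟨ha, hb, hbD, hdvd, -⟩
  dsimp only at ha hb hbD hdvd
  simp only [Finset.coe_product, Finset.coe_range, Set.mem_prod, Set.mem_Iio]
  have h1 : 4 * a ≤ D - b ^ 2 := Nat.le_of_dvd (by omega) hdvd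
  have h2 : b ≤ b ^ 2 := by nlinarith
  omega

/-! ## The registered stub (signature verbatim) -/

/-- **S6a `stub_redIdealsPerClass`.** Every ideal class `C` of a real quadratic field `F` (discriminant
`D = d_F > 0`, `F ∋ α`, `α² = m` square-free) contains at least `R_F/log(2√D)` REDUCED ideals
`[a, (b + √D)/2]` — integer pairs `(a, b)` with `a ≥ 1`, `0 < b < √D`, `4a ∣ D − b²`, `|√D − 2a| < b`
(all comparisons squared) —, counted in the S5 query format `span {fmtA, fmtR + α}`,
`(fmtA, fmtR) = (a, b/2)` if `4 ∣ D` (the ideal `[a, (b+√D)/2]` itself, `√D = 2α`) and `(2a, b)` if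
`D ≡ 1 (4)` (twice it, `√D = α`; same class). Proof: the tree's cycle of reduced ideals of a class
(`Quadratic.exists_reduced_pairs_of_class`: Minkowski + Hermite form give a reduced ideal-shaped
quotient `x = (b + √D)/(2a)` in `C`; its continued-fraction cycle stays in `C`, is injective on pairs,
and the product of the `ψ_k < 2√D` over the period `ℓ` is a unit `≥ ε_D`, so `log ε_D ≤ ℓ log(2√D)`),
`R_F = log ε_D` (`Quadratic.regulator_eq_log_fundUnit'`), an integral basis `(1, ω)` adjusted so that
`2ω − t = 2α` resp. `α` and a real embedding with `σ(α) > 0`; the format bridge is the parity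
computation `b/2 + α = ω − (t − b)/2` resp. `b + α = 2(ω − (t − b)/2)`.
[cite: JacobsonWilliams2008, §5.3 Thm 5.18] [cite: Cohen1993, §5.6–5.7] -/
theorem stub_redIdealsPerClass :
    ∀ (F : Type) [Field F] [NumberField F], Module.finrank ℚ F = 2 → 0 < NumberField.discr F →
      ∀ (m : ℕ) (α : 𝓞 F), Squarefree m → 2 ≤ m → (α : F) ^ 2 = (m : F) →
        ∀ C : ClassGroup (𝓞 F),
          NumberField.Units.regulator F / Real.log (2 * Real.sqrt (NumberField.discr F : ℝ)) ≤
            Nat.card {ab : ℕ × ℕ //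
              (0 < ab.1 ∧ 0 < ab.2 ∧ ab.2 ^ 2 < (NumberField.discr F).toNat ∧
                4 * ab.1 ∣ (NumberField.discr F).toNat - ab.2 ^ 2 ∧
                (NumberField.discr F).toNat < (2 * ab.1 + ab.2) ^ 2 ∧
                (2 * ab.1 ≤ ab.2 ∨ (2 * ab.1 - ab.2) ^ 2 < (NumberField.discr F).toNat)) ∧
              ∃ hI : Ideal.span {((if 4 ∣ (NumberField.discr F).toNat then ab.1 else 2 * ab.1 : ℕ) : 𝓞 F),
                  ((if 4 ∣ (NumberField.discr F).toNat then ab.2 / 2 else ab.2 : ℕ) : 𝓞 F) + α} ∈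
                    (Ideal (𝓞 F))⁰,
                ClassGroup.mk0 ⟨_, hI⟩ = C} := by
  intro F _ _ h2 hd m α hsf h2m hα C
  classical
  -- the discriminant as a natural number `D`: not a square, `≡ 0, 1 (mod 4)`, `= fundDiscr m`
  set D : ℕ := (NumberField.discr F).toNat with hDdef
  have hdisc : NumberField.discr F = (D : ℤ) := (Int.toNat_of_nonneg hd.le).symm
  have hD : ¬ IsSquare D := Quadratic.not_isSquare_discr_toNat h2 hd
  have hD4 : D % 4 = 0 ∨ D % 4 = 1 := Quadratic.discr_toNat_mod_four h2 hd
  have hfd : (D : ℤ) = Quadratic.fundDiscr m := by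
    rw [← hdisc]; exact Quadratic.discr_eq_fundDiscr h2 hsf h2m hα
  have hDm : (4 ∣ D ∧ (D : ℤ) = 4 * m) ∨ (¬ 4 ∣ D ∧ (D : ℤ) = m) := by
    by_cases hm4 : m % 4 = 1
    · right
      rw [Quadratic.fundDiscr_of_mod_four_eq_one hm4] at hfd
      refine ⟨?_, hfd⟩
      have : D = m := by exact_mod_cast hfd
      omega
    · left
      rw [Quadratic.fundDiscr_of_mod_four_ne_one hm4] at hfd
      refine ⟨?_, hfd⟩
      have : D = 4 * m := by exact_mod_cast hfd
      exact ⟨m, this⟩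
  -- an integral basis `(1, ω)` with `ω² = n + tω`, `D = t² + 4n` and `2ω − t = β`, `β = 2α` resp. `α`
  obtain ⟨b₀, hb₀⟩ := Quadratic.exists_basis_zero_eq_one (K := F) h2
  have hω₀ := Quadratic.basis_one_mul_self_eq b₀ hb₀
  have hDt₀ := Quadratic.discr_eq_sq_add_four_mul b₀ hb₀
  set n : ℤ := b₀.repr (b₀ 1 * b₀ 1) 0 with hn
  set t : ℤ := b₀.repr (b₀ 1 * b₀ 1) 1 with ht
  have hDt : (D : ℤ) = t ^ 2 + 4 * n := by rw [← hdisc, hDt₀]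
  have hαO : α ^ 2 = (m : 𝓞 F) := by
    apply RingOfIntegers.coe_injective
    simp only [map_pow, map_natCast]
    exact hα
  set β : 𝓞 F := if 4 ∣ D then 2 * α else α with hβdef
  have hβ2 : β ^ 2 = ((t ^ 2 + 4 * n : ℤ) : 𝓞 F) := by
    rw [← hDt]
    rcases hDm with ⟨h4, hD4m⟩ | ⟨h4, hD1m⟩
    · rw [hβdef, if_pos h4, hD4m]; push_cast; linear_combination 4 * hαO
    · rw [hβdef, if_neg h4, hD1m]; push_cast; exact hαO
  obtain ⟨b, hb, hω, hδ⟩ := exists_basis_two_mul_sub_eq b₀ hb₀ hω₀ hβ2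
  -- a real embedding with `σ(α) > 0`, hence `2σ(ω) − t = σ(β) = √D`
  obtain ⟨σ, hσα⟩ := exists_ringHom_apply_pos h2 hd hsf h2m hα
  have hσβ : 0 < σ (algebraMap (𝓞 F) F β) := by
    have e : σ (algebraMap (𝓞 F) F α) = σ (α : F) := rfl
    rcases hDm with ⟨h4, -⟩ | ⟨h4, -⟩
    · rw [hβdef, if_pos h4, map_mul, map_mul, map_ofNat, map_ofNat, e]; linarith
    · rw [hβdef, if_neg h4, e]; exact hσα
  have hσ : 2 * σ (b 1 : F) - t = Real.sqrt D := by
    have e1 := congrArg (fun z : 𝓞 F => σ (algebraMap (𝓞 F) F z)) hδ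
    have e2 := congrArg (fun z : 𝓞 F => σ (algebraMap (𝓞 F) F z)) hβ2
    simp only [map_mul, map_sub, map_pow, map_ofNat, map_intCast] at e1 e2
    rw [← hDt] at e2
    push_cast at e2
    rw [RingOfIntegers.coe_eq_algebraMap, e1, ← e2, Real.sqrt_sq hσβ.le]
  -- the cycle of reduced ideals of `C`
  obtain ⟨ℓ, f, hf, hlog, hspec⟩ :=
    Quadratic.exists_reduced_pairs_of_class b hb hω hDt σ hσ hD hD4 h2 hdisc C
  -- parities of `t` and of the `b`-components
  have htpar : (4 ∣ D → ∃ t₁ : ℤ, t = 2 * t₁) ∧ (¬ 4 ∣ D → ∃ t₁ : ℤ, t = 2 * t₁ + 1) := by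
    obtain ⟨t₁, ht₁⟩ := Int.even_or_odd' t
    constructor
    · intro h4
      rcases ht₁ with ht₁ | ht₁
      · exact ⟨t₁, ht₁⟩
      · exfalso
        have hD' : (D : ℤ) = 4 * (t₁ ^ 2 + t₁ + n) + 1 := by rw [hDt, ht₁]; ring
        omega
    · intro h4
      rcases ht₁ with ht₁ | ht₁
      · exfalso
        have hD' : (D : ℤ) = 4 * (t₁ ^ 2 + n) := by rw [hDt, ht₁]; ring
        omega
      · exact ⟨t₁, ht₁⟩
  have hbpar : ∀ {a c : ℕ}, 0 < a → c ^ 2 < D → 4 * a ∣ D - c ^ 2 →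
      (4 ∣ D → ∃ c₁ : ℕ, c = 2 * c₁) ∧ (¬ 4 ∣ D → ∃ c₁ : ℕ, c = 2 * c₁ + 1) := by
    intro a c ha hcD hdvd
    obtain ⟨q, hq⟩ := hdvd
    have hDq : D = 4 * (a * q) + c ^ 2 := by rw [← mul_assoc]; omega
    obtain ⟨c₁, hc₁⟩ := Nat.even_or_odd' c
    constructor
    · intro h4
      rcases hc₁ with hc₁ | hc₁
      · exact ⟨c₁, hc₁⟩
      · exfalso
        have : D = 4 * (a * q + c₁ ^ 2 + c₁) + 1 := by rw [hDq, hc₁]; ring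
        omega
    · intro h4
      rcases hc₁ with hc₁ | hc₁
      · exfalso
        have : D = 4 * (a * q + c₁ ^ 2) := by rw [hDq, hc₁]; ring
        omega
      · exact ⟨c₁, hc₁⟩
  -- the format bridge: the S5-format ideal of the pair `f i` is `(u) · 𝔞_i`, `u = 1` resp. `2`
  have hbridge : ∀ i, ∃ u : 𝓞 F, u ≠ 0 ∧
      Ideal.span {((if 4 ∣ D then (f i).1 else 2 * (f i).1 : ℕ) : 𝓞 F),
        ((if 4 ∣ D then (f i).2 / 2 else (f i).2 : ℕ) : 𝓞 F) + α} =
      Ideal.span {u} * Ideal.span {((f i).1 : 𝓞 F), b 1 - ((((t - (f i).2) / 2 : ℤ)) : 𝓞 F)} := by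
    intro i
    obtain ⟨⟨ha, -, hcD, hdvd, -, -⟩, -⟩ := hspec i
    obtain ⟨hc_ev, hc_odd⟩ := hbpar ha hcD hdvd
    rcases hDm with ⟨h4, -⟩ | ⟨h4, -⟩
    · obtain ⟨t₁, ht₁⟩ := htpar.1 h4
      obtain ⟨c₁, hc₁⟩ := hc_ev h4
      refine ⟨1, one_ne_zero, ?_⟩
      rw [Ideal.span_singleton_one, Ideal.top_mul, if_pos h4, if_pos h4, hc₁, ht₁,
        Nat.mul_div_cancel_left _ two_pos]
      have hk : (2 * t₁ - ((2 * c₁ : ℕ) : ℤ)) / 2 = t₁ - c₁ := by omega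
      rw [hk]
      -- `c₁ + α = ω − (t₁ − c₁)` since `2α = 2ω − t = 2ω − 2t₁`
      have hαω : α = b 1 - (t₁ : 𝓞 F) := by
        have h2 : (2 : 𝓞 F) * (α - (b 1 - (t₁ : 𝓞 F))) = 0 := by
          rw [hβdef, if_pos h4, ht₁] at hδ
          push_cast at hδ
          linear_combination -hδ
        rcases mul_eq_zero.mp h2 with h | h
        · exact absurd h two_ne_zero
        · exact sub_eq_zero.mp h
      congr 2
      rw [hαω]; push_cast; ring
    · obtain ⟨t₁, ht₁⟩ := htpar.2 h4
      obtain ⟨c₁, hc₁⟩ := hc_odd h4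
      refine ⟨2, two_ne_zero, ?_⟩
      rw [if_neg h4, if_neg h4, Quadratic.span_singleton_mul_span_pair, hc₁, ht₁]
      have hk : (2 * t₁ + 1 - ((2 * c₁ + 1 : ℕ) : ℤ)) / 2 = t₁ - c₁ := by omega
      rw [hk]
      have hαω : α = 2 * b 1 - (t : 𝓞 F) := by rw [hβdef, if_neg h4] at hδ; exact hδ.symm
      congr 2
      · push_cast; ring
      · rw [hαω, ht₁]; push_cast; ring
  -- the injection `Fin ℓ ↪ T`
  have hT : ∀ i, ((0 < (f i).1 ∧ 0 < (f i).2 ∧ (f i).2 ^ 2 < D ∧ 4 * (f i).1 ∣ D - (f i).2 ^ 2 ∧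
      D < (2 * (f i).1 + (f i).2) ^ 2 ∧ (2 * (f i).1 ≤ (f i).2 ∨ (2 * (f i).1 - (f i).2) ^ 2 < D)) ∧
      ∃ hI : Ideal.span {((if 4 ∣ D then (f i).1 else 2 * (f i).1 : ℕ) : 𝓞 F),
          ((if 4 ∣ D then (f i).2 / 2 else (f i).2 : ℕ) : 𝓞 F) + α} ∈ (Ideal (𝓞 F))⁰,
        ClassGroup.mk0 ⟨_, hI⟩ = C) := by
    intro i
    obtain ⟨hP, hI, hC⟩ := hspec i
    obtain ⟨u, hu, hJ⟩ := hbridge i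
    have hmem : Ideal.span {u} * Ideal.span {((f i).1 : 𝓞 F), b 1 - ((((t - (f i).2) / 2 : ℤ)) : 𝓞 F)} ∈
        (Ideal (𝓞 F))⁰ :=
      mul_mem (mem_nonZeroDivisors_of_ne_zero (by rw [Ne, Ideal.zero_eq_bot, Ideal.span_singleton_eq_bot]; exact hu)) hI
    refine ⟨hP, hJ ▸ hmem, ?_⟩
    rw [← hC, ← mk0_span_singleton_mul_eq hI hu hmem]
    congr 1
    exact Subtype.ext hJ
  haveI hfin : Finite {ab : ℕ × ℕ //
      (0 < ab.1 ∧ 0 < ab.2 ∧ ab.2 ^ 2 < D ∧ 4 * ab.1 ∣ D - ab.2 ^ 2 ∧ D < (2 * ab.1 + ab.2) ^ 2 ∧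
        (2 * ab.1 ≤ ab.2 ∨ (2 * ab.1 - ab.2) ^ 2 < D)) ∧
      ∃ hI : Ideal.span {((if 4 ∣ D then ab.1 else 2 * ab.1 : ℕ) : 𝓞 F),
          ((if 4 ∣ D then ab.2 / 2 else ab.2 : ℕ) : 𝓞 F) + α} ∈ (Ideal (𝓞 F))⁰,
        ClassGroup.mk0 ⟨_, hI⟩ = C} := by
    haveI := (finite_setOf_pairs D (fun _ => True)).to_subtype
    refine Finite.of_injective (fun x => (⟨x.1, ?_⟩ : {ab : ℕ × ℕ |
      (0 < ab.1 ∧ 0 < ab.2 ∧ ab.2 ^ 2 < D ∧ 4 * ab.1 ∣ D - ab.2 ^ 2 ∧ True)})) ?_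
    · obtain ⟨⟨h1, h2', h3, h4, -⟩, -⟩ := x.2; exact ⟨h1, h2', h3, h4, trivial⟩
    · intro x y hxy
      have h := congrArg Subtype.val hxy
      exact Subtype.ext h
  have hcard := Nat.card_le_card_of_injective (fun i : Fin ℓ => (⟨f i, hT i⟩ : {ab : ℕ × ℕ //
      (0 < ab.1 ∧ 0 < ab.2 ∧ ab.2 ^ 2 < D ∧ 4 * ab.1 ∣ D - ab.2 ^ 2 ∧ D < (2 * ab.1 + ab.2) ^ 2 ∧
        (2 * ab.1 ≤ ab.2 ∨ (2 * ab.1 - ab.2) ^ 2 < D)) ∧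
      ∃ hI : Ideal.span {((if 4 ∣ D then ab.1 else 2 * ab.1 : ℕ) : 𝓞 F),
          ((if 4 ∣ D then ab.2 / 2 else ab.2 : ℕ) : 𝓞 F) + α} ∈ (Ideal (𝓞 F))⁰,
        ClassGroup.mk0 ⟨_, hI⟩ = C}))
    (fun i j hij => hf (congrArg Subtype.val hij))
  rw [Nat.card_eq_fintype_card, Fintype.card_fin] at hcard
  -- conclusion: `R_F = log ε_D ≤ ℓ log(2√D) ≤ #T · log(2√D)`
  have hreg : NumberField.Units.regulator F = Real.log (QuadIrr.fundUnit D) :=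
    Quadratic.regulator_eq_log_fundUnit' h2 hd
  have hD1 : (1 : ℝ) ≤ D := by
    have : D ≠ 0 := by rintro h0; exact hD ⟨0, by rw [h0]⟩
    exact_mod_cast Nat.one_le_iff_ne_zero.mpr this
  have hlogpos : 0 < Real.log (2 * Real.sqrt D) := by
    apply Real.log_pos
    have := Real.one_le_sqrt.mpr hD1
    linarith
  have hsqrt : Real.sqrt (NumberField.discr F : ℝ) = Real.sqrt D := by rw [hdisc]; push_cast; rfl
  rw [hsqrt, div_le_iff₀ hlogpos, hreg]
  calc Real.log (QuadIrr.fundUnit D) ≤ ℓ * Real.log (2 * Real.sqrt D) := hlog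
    _ ≤ _ := by
      apply mul_le_mul_of_nonneg_right _ hlogpos.le
      exact_mod_cast hcard

/-! ## Consumers (appended 2026-08-16T16:40Z, no declaration changed)

`stub_redIdealsPerClass` is consumed by the crux assembly `Theorems/ArithStatLadderIqThreeMemBQP.lean`
(`IqThreeMemBQP_of_facts`, the composition of line `scholz-mirror-siegel`), through
`stub_realWitnessOfParts stub_redIdealsPerClass _` (the real torsion-witness sampler, S6b). -/

end Summit.QuantumAdvantage.QuantumAdvantage.Theorems.ArithStatLadder.IqThreeMemBQP

end
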